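import Literature.AlgebraicGeometry.Motives.AbelianVarietyDegree
import Literature.AlgebraicGeometry.Motives.AbelianVarietyProofs
import HarnessLib

/-!
# A proper scheme over a field carrying an ample Cartier divisor is projective

Görtz–Wedhorn I, Summary 13.71 (3) with (v) ⇒ (i) (pp. 511–512; over the affine base `Spec k`):
"there exists an `f`-ample line bundle on `X` and `X` is proper over `S`" implies "there exists a
closed `S`-immersion `X ↪ ℙⁿ_S` for some `n ≥ 0`". This file proves it for the line bundles
`𝒪_X(D)` of Cartier divisors `D` on an integral scheme `X` (`Motives/CartierDivisor`), whose
ampleness is recorded there in the form of Prop. 13.47 (iv) (`CartierDivisor.IsAmple`: `X` qcqs and,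
for some `d ≥ 1`, every point lies in an affine `X_s`, `s ∈ Γ(X, 𝒪_X(d • D))`):

* `CartierDivisor.toGeneratingSections`: global sections `s i ∈ Γ(X, 𝒪_X(D)) ⊆ K(X)` whose
  non-vanishing loci `X_{s i}` cover `X` are generating sections in the chart form
  `Literature.AlgebraicGeometry.Motives.GeneratingSections` of `Motives/MorphismsToProjectiveSpace` — opens `X_{s i}` and ratios
  `s j / s i ∈ Γ(X_{s i}, 𝒪_X)` (the rational function `s j / s i` is regular on `X_{s i}`, hence a
  section there by `Γ(U, 𝒪_X) = ⋂_{x ∈ U} 𝒪_{X,x}`, Görtz–Wedhorn I, Prop. 3.29 (3),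
  `RatFn.exists_germ_eq_of_forall_isRegularAt`), with `X_{s j / s i} = X_{s i} ∩ X_{s j}` and the
  cocycle rule read off in `K(X)`;
* `CartierDivisor.IsAmple.exists_generatingSections`: an ample `D` yields generating sections
  indexed by some `Fin (n + 1)` all of whose non-vanishing loci are affine (finitely many of the
  affine `X_s` of Prop. 13.47 (iv) cover the quasi-compact `X`);
* `CartierDivisor.IsAmple.isProjectiveOver`: **if `X` is proper over a field `k` and carries an
  ample Cartier divisor, then `X` is projective over `k`** (`Literature.AlgebraicGeometry.Motives.IsProjectiveOver`: a closed
  `k`-immersion into some `ℙⁿ_k`), by `GeneratingSections.isProjectiveOver_of_isAffineOpen`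
  (`Motives/ProjectiveOfGeneratingSections`: the morphism to `ℙⁿ_k` defined by generating sections
  with affine non-vanishing loci is affine and proper, hence finite, and a proper `k`-scheme finite
  over `ℙⁿ_k` is projective; Görtz–Wedhorn I, Thm. 13.84 with Cor. 13.72 and Cor. 12.89);
* for an abelian variety `A` over a field: `AbelianVariety.isProjectiveOver_of_isAmple`, and the
  converse `AbelianVariety.isProjectiveOver_iff_exists_isAmple_symmetric` of
  `AbelianVariety.exists_isAmple_symmetric_of_isProjectiveOver` (`Motives/AbelianVarietyDegree`):
  the named facts `Literature.AlgebraicGeometry.Motives.AbelianVariety.isProjectiveOver` (`Motives/CyclesAbelianVarieties`) and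
  `AbelianVariety.exists_isAmple_symmetric` (Görtz–Wedhorn II, Prop. 27.174 with Rem. 27.185) are
  equivalent, and either gives the named fact `AbelianVariety.isSmoothProjective`
  (`isSmoothProjective_of_isAmple`, via `Motives/AbelianVarietyProofs`).

Mathlib searched (pin): `germ_injective_of_isIntegral`, `Scheme.mem_basicOpen`,
`IsCompact.elim_finite_subcover`, `Finset.equivFin` (all used); Mathlib has no ample line bundles
or Cartier divisors (cf. `Motives/CartierDivisor`), and the tree had only the converse direction
`GeneratingSections.divisor` / `GeneratingSections.isAmple_divisor` (`Motives/AbelianVarietyDegree`).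

## References

* U. Görtz, T. Wedhorn, *Algebraic Geometry I: Schemes*, 2nd ed., Springer Spektrum (2020),
  doi:10.1007/978-3-658-30733-2: Prop. 3.29 (3) (p. 102); Def. 13.44 and Prop. 13.47 (pp. 492–493);
  Summary 13.71 and Cor. 13.72 (pp. 511–512); Thm. 13.84 (p. 516). [GortzWedhorn2020]
* U. Görtz, T. Wedhorn, *Algebraic Geometry II: Cohomology of Schemes*, Springer Spektrum (2023),
  doi:10.1007/978-3-658-43031-3: Prop. 27.174 (p. 880), Rem. 27.185 (p. 887). [GortzWedhorn2023]
-/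

universe u

open CategoryTheory AlgebraicGeometry TopologicalSpace Opposite Literature.AlgebraicGeometry.Motives.RatFn

noncomputable section

namespace Literature.AlgebraicGeometry.Motives

namespace CartierDivisor

variable {X : Scheme.{u}} [IsIntegral X] (D : CartierDivisor X)

/-! ### Quotients of sections of `𝒪_X(D)` -/

omit [IsIntegral X] in
/-- A nonempty open of the integral scheme `X` contains the generic point. [folklore] -/
theorem genericPoint_mem_of_mem [IrreducibleSpace X] {U : X.Opens} {x : X} (hx : x ∈ U) :
    genericPoint X ∈ U :=
  ((genericPoint_spec X).mem_open_set_iff U.isOpen).2 ⟨x, Set.mem_univ _, hx⟩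

variable {D}

/-- A section of `𝒪_X(D)` with a point in its non-vanishing locus is a nonzero rational function.
[folklore] -/
theorem ne_zero_of_mem_nonvanishing {s : X.functionField} {x : X} (hx : x ∈ D.nonvanishing s) :
    s ≠ 0 := by
  obtain ⟨i, -, hu⟩ := hx
  exact fun h => hu.ne_zero (by rw [h, mul_zero])

/-- On the non-vanishing locus `X_s` of a section `s` of `𝒪_X(D)`, the quotient `t / s` of a
section `t` by `s` is a regular function (`t / s = (fᵢ t) / (fᵢ s)` with `fᵢ s ∈ 𝒪_{X,x}^×`;
Görtz–Wedhorn I, (7.11): `𝓛_{|X_s} ≅ 𝒪_{X_s}` via `s`). [folklore] -/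
theorem isRegularAt_div_of_mem_nonvanishing {s t : X.functionField} (ht : D.IsSection t) {x : X}
    (hx : x ∈ D.nonvanishing s) : IsRegularAt x (t / s) := by
  obtain ⟨a, ha, hu⟩ := hx
  have e : t / s = D.f a * t * (D.f a * s)⁻¹ := by
    rw [← div_eq_mul_inv, mul_div_mul_left _ _ (D.f_ne_zero a)]
  rw [e]
  exact (ht a x ha).mul hu.inv.isRegularAt

/-- On `X_s`, the quotient `t / s` is a unit at `x` iff `x ∈ X_t`. [folklore] -/
theorem isUnitAt_div_iff_mem_nonvanishing {s t : X.functionField} {x : X}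
    (hx : x ∈ D.nonvanishing s) : IsUnitAt x (t / s) ↔ x ∈ D.nonvanishing t := by
  obtain ⟨a, ha, hu⟩ := hx
  rw [D.mem_nonvanishing_iff ha]
  have e : t / s = D.f a * t / (D.f a * s) := by rw [mul_div_mul_left _ _ (D.f_ne_zero a)]
  rw [e]
  refine ⟨fun h => ?_, fun h => h.div hu⟩
  have h' := h.mul hu
  rwa [div_mul_cancel₀ _ hu.ne_zero] at h'

/-! ### Generating sections from sections of `𝒪_X(D)` without common zero -/

section ToGeneratingSections

variable (D)
variable {ι : Type} (s : ι → X.functionField) (hs : ∀ i, D.IsSection (s i))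
  (hξ : ∀ i, genericPoint X ∈ D.nonvanishingOpens (s i))

/-- The ratio `s j / s i` as a regular function on `X_{s i}` (the section of `𝒪_X` over the
nonempty open `X_{s i}` whose rational function is `s j / s i`, which is regular there;
Görtz–Wedhorn I, Prop. 3.29 (3)). [folklore] -/
def ratio (i j : ι) : Γ(X, D.nonvanishingOpens (s i)) :=
  (exists_germ_eq_of_forall_isRegularAt (hξ i)
    (fun _ hy => isRegularAt_div_of_mem_nonvanishing (hs j) hy)).choose

/-- The rational function of `ratio i j` is `s j / s i`. [folklore] -/
theorem germ_ratio (i j : ι) (h : genericPoint X ∈ D.nonvanishingOpens (s i)) :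
    X.presheaf.germ (D.nonvanishingOpens (s i)) (genericPoint X) h (D.ratio s hs hξ i j) =
      s j / s i :=
  (exists_germ_eq_of_forall_isRegularAt (hξ i)
    (fun _ hy => isRegularAt_div_of_mem_nonvanishing (hs j) hy)).choose_spec

/-- At a point `x ∈ X_{s i}`, the germ of `ratio i j`, read in `K(X)`, is `s j / s i`. [folklore] -/
theorem toFunctionField_germ_ratio (i j : ι) {x : X} (hx : x ∈ D.nonvanishingOpens (s i)) :
    toFunctionField x (X.presheaf.germ _ x hx (D.ratio s hs hξ i j)) = s j / s i := by
  rw [toFunctionField_germ, D.germ_ratio s hs hξ i j]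

/-- `X_{ratio i j} = X_{s i} ∩ X_{s j}`: the quotient `s j / s i` is invertible on `X_{s i}` exactly
where `s j` generates. [folklore] -/
theorem basicOpen_ratio (i j : ι) :
    X.basicOpen (D.ratio s hs hξ i j) = D.nonvanishingOpens (s i) ⊓ D.nonvanishingOpens (s j) := by
  ext x
  constructor
  · intro hx
    have hxi : x ∈ D.nonvanishingOpens (s i) := X.basicOpen_le _ hx
    refine ⟨hxi, ?_⟩
    have hu := (isUnitAt_germ_iff hxi (D.ratio s hs hξ i j)).2 hx
    rw [D.toFunctionField_germ_ratio s hs hξ i j hxi] at hu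
    exact (isUnitAt_div_iff_mem_nonvanishing hxi).1 hu
  · rintro ⟨hxi, hxj⟩
    have hu : IsUnitAt x (s j / s i) := (isUnitAt_div_iff_mem_nonvanishing hxi).2 hxj
    rw [← D.toFunctionField_germ_ratio s hs hξ i j hxi] at hu
    exact (isUnitAt_germ_iff hxi _).1 hu

/-- `s i / s i = 1`. [folklore] -/
theorem ratio_self (i : ι) : D.ratio s hs hξ i i = 1 := by
  apply germ_injective_of_isIntegral _ (genericPoint X) (hξ i)
  rw [D.germ_ratio s hs hξ, map_one, div_self (ne_zero_of_mem_nonvanishing (hξ i))]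

/-- The cocycle rule `(s j / s i) (s l / s j) = s l / s i` on `X_{s i} ∩ X_{s j}`. [folklore] -/
theorem ratio_mul_ratio (i j l : ι) :
    X.presheaf.map (homOfLE inf_le_left).op (D.ratio s hs hξ i j) *
        X.presheaf.map (homOfLE inf_le_right).op (D.ratio s hs hξ j l) =
      X.presheaf.map (homOfLE (inf_le_left :
        D.nonvanishingOpens (s i) ⊓ D.nonvanishingOpens (s j) ≤ _)).op (D.ratio s hs hξ i l) := by
  have hmem : genericPoint X ∈ D.nonvanishingOpens (s i) ⊓ D.nonvanishingOpens (s j) :=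
    ⟨hξ i, hξ j⟩
  apply germ_injective_of_isIntegral _ (genericPoint X) hmem
  simp only [map_mul, TopCat.Presheaf.germ_res_apply, D.germ_ratio s hs hξ]
  have hj : s j ≠ 0 := ne_zero_of_mem_nonvanishing (hξ j)
  have hi : s i ≠ 0 := ne_zero_of_mem_nonvanishing (hξ i)
  field_simp

/-- **Generating sections from sections of `𝒪_X(D)` without common zero.** Sections
`s i ∈ Γ(X, 𝒪_X(D))` (`i ∈ ι`) whose non-vanishing loci `X_{s i}` are nonempty and cover `X`
define generating-sections data (`Motives/MorphismsToProjectiveSpace`): the opens `X_{s i}` and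
the ratios `s j / s i ∈ Γ(X_{s i}, 𝒪_X)` — i.e. the `s i` generate the invertible sheaf `𝒪_X(D)`
(Görtz–Wedhorn I, (13.12): the morphism `X → ℙ(ι)` defined by generating sections; Hartshorne II,
Thm. 7.1). [folklore] -/
def toGeneratingSections (hcov : ∀ x : X, ∃ i, x ∈ D.nonvanishing (s i)) :
    GeneratingSections ι X where
  U i := D.nonvanishingOpens (s i)
  iSup_U := top_le_iff.1 fun x _ => Opens.mem_iSup.2 (hcov x)
  ratio := D.ratio s hs hξ
  ratio_self := D.ratio_self s hs hξ
  basicOpen_ratio := D.basicOpen_ratio s hs hξ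
  ratio_mul_ratio := D.ratio_mul_ratio s hs hξ

/-- The charts of `toGeneratingSections` are the non-vanishing loci `X_{s i}`. [folklore] -/
@[simp]
theorem toGeneratingSections_U (hcov : ∀ x : X, ∃ i, x ∈ D.nonvanishing (s i)) (i : ι) :
    (D.toGeneratingSections s hs hξ hcov).U i = D.nonvanishingOpens (s i) := rfl

end ToGeneratingSections

/-! ### Ample divisors give finitely many affine generating sections -/

/-- **An ample Cartier divisor yields finitely many generating sections with affine non-vanishing
loci** (Görtz–Wedhorn I, Prop. 13.47 (iv): for `𝓛 = 𝒪_X(D)` ample on the qcqs scheme `X` there are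
`d ≥ 1` and finitely many `s_i ∈ Γ(X, 𝓛^{⊗d})` with `X_{s_i}` affine and `X = ⋃ X_{s_i}`): the
sections of `𝒪_X(d • D)` provided by `IsAmple` at the points of `X` have affine non-vanishing loci
covering the quasi-compact `X`, so finitely many of them (indexed by `Fin (n + 1)`, `X` being
nonempty) already cover, and these are generating sections (`toGeneratingSections`).
[cite: GortzWedhorn2020, Prop. 13.47 (iv) (p. 493)] -/
theorem IsAmple.exists_generatingSections (hD : D.IsAmple) :
    ∃ (n : ℕ) (G : GeneratingSections (Fin (n + 1)) X), ∀ i, IsAffineOpen (G.U i) := by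
  classical
  obtain ⟨hc, _, d, _, h⟩ := hD
  choose s hs hmem haff using h
  let V : X → Set X := fun x => ((d • D).nonvanishingOpens (s x) : Set X)
  have hcover : (Set.univ : Set X) ⊆ ⋃ x, V x := fun x _ => Set.mem_iUnion.2 ⟨x, hmem x⟩
  obtain ⟨t, ht⟩ := isCompact_univ.elim_finite_subcover V (fun x => ((d • D).nonvanishingOpens (s x)).isOpen) hcover
  have htne : t.Nonempty := by
    obtain ⟨x⟩ := (inferInstance : Nonempty X)
    obtain ⟨y, hy, -⟩ := Set.mem_iUnion₂.1 (ht (Set.mem_univ x))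
    exact ⟨y, hy⟩
  obtain ⟨n, hn⟩ : ∃ n, t.card = n + 1 :=
    Nat.exists_eq_succ_of_ne_zero (Finset.card_ne_zero.2 htne)
  let e : Fin (n + 1) ≃ ↥t := (t.equivFin.trans (finCongr hn)).symm
  let s' : Fin (n + 1) → X.functionField := fun i => s (e i)
  have hcov : ∀ x : X, ∃ i, x ∈ (d • D).nonvanishing (s' i) := fun x => by
    obtain ⟨y, hy, hxy⟩ := Set.mem_iUnion₂.1 (ht (Set.mem_univ x))
    refine ⟨e.symm ⟨y, hy⟩, ?_⟩
    simp only [s', Equiv.apply_symm_apply]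
    exact hxy
  refine ⟨n, (d • D).toGeneratingSections s' (fun i => hs _)
    (fun i => genericPoint_mem_of_mem (hmem (e i))) hcov, fun i => ?_⟩
  rw [toGeneratingSections_U]
  exact haff _

/-- **A proper scheme over a field carrying an ample Cartier divisor is projective**
(Görtz–Wedhorn I, Summary 13.71 (3), (v) ⇒ (i): over the affine base `S = Spec k`, "there exists an
`f`-ample line bundle on `X` and `X` is proper over `S`" implies "there exists a closed
`S`-immersion `X ↪ ℙⁿ_S`"), for `𝓛 = 𝒪_X(D)` on an integral `X`: the finitely many affine
generating sections of `IsAmple.exists_generatingSections` define an affine, proper, hence finite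
morphism `X → ℙⁿ_k`, and a proper `k`-scheme finite over `ℙⁿ_k` is projective
(`GeneratingSections.isProjectiveOver_of_isAffineOpen`, `Motives/ProjectiveOfGeneratingSections`).
[cite: GortzWedhorn2020, Summary 13.71 (3) (pp. 511–512)] -/
theorem IsAmple.isProjectiveOver {k : Type u} [Field k] {Z : SchemeOver k} [IsIntegral Z.left]
    [IsProper Z.hom] {D : CartierDivisor Z.left} (hD : D.IsAmple) : IsProjectiveOver Z := by
  obtain ⟨n, G, hG⟩ := hD.exists_generatingSections
  exact G.isProjectiveOver_of_isAffineOpen hG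

end CartierDivisor

/-! ### Abelian varieties: projectivity is the existence of an ample divisor -/

namespace AbelianVariety

variable {K : Type u} [Field K] (A : AbelianVariety K)

/-- An abelian variety carrying an ample Cartier divisor is projective (it is proper over `K`;
`CartierDivisor.IsAmple.isProjectiveOver`). [folklore] -/
theorem isProjectiveOver_of_isAmple {D : CartierDivisor A.X.left} (hD : D.IsAmple) :
    IsProjectiveOver A.X :=
  hD.isProjectiveOver

/-- The named fact `exists_isAmple_symmetric A` (a symmetric ample divisor; Görtz–Wedhorn II,
Prop. 27.174 with Rem. 27.185) gives projectivity of `A`. [folklore] -/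
theorem isProjectiveOver_of_exists_isAmple_symmetric (h : A.exists_isAmple_symmetric) :
    IsProjectiveOver A.X := by
  obtain ⟨D, hD, -⟩ := h
  exact A.isProjectiveOver_of_isAmple hD

/-- **Projectivity of an abelian variety is equivalent to the existence of a symmetric ample
divisor** (`exists_isAmple_symmetric_of_isProjectiveOver` of `Motives/AbelianVarietyDegree` and its
converse): the named facts `Literature.AlgebraicGeometry.Motives.AbelianVariety.isProjectiveOver` and
`AbelianVariety.exists_isAmple_symmetric` say the same thing. [folklore] -/
theorem isProjectiveOver_iff_exists_isAmple_symmetric :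
    IsProjectiveOver A.X ↔ A.exists_isAmple_symmetric :=
  ⟨A.exists_isAmple_symmetric_of_isProjectiveOver, A.isProjectiveOver_of_exists_isAmple_symmetric⟩

/-- The named fact `A.isSmoothProjective` (`Motives/AbelianVariety`: smooth of relative dimension
`dim A`, projective, geometrically irreducible) from an ample Cartier divisor on `A`, everything but
projectivity being proved in `Motives/AbelianVarietyProofs`. [folklore] -/
theorem isSmoothProjective_of_isAmple {D : CartierDivisor A.X.left} (hD : D.IsAmple) :
    A.isSmoothProjective :=
  A.isSmoothProjective_of_isProjectiveOver (A.isProjectiveOver_of_isAmple hD)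

end AbelianVariety

end Literature.AlgebraicGeometry.Motives
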